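import Literature.NumberTheory.Weil1964.AdelicMetaplecticGroup
import Literature.NumberTheory.Automorphic.AdelicTensorStripping
import Literature.Analysis.SegalBargmann.SchwartzCarrierTransport
import HarnessLib

/-!
# The archimedean Schrödinger–Folland dictionary for the adelic Heisenberg group

Origin: `pub-hodgecm` MODEL-CONSTRUCTION sub-cell, node W2-⊗ (⊗S)-𝔸 (iii)(d1). KERNEL MATHEMATICS ONLY: no
`def … : Prop` records, no `axiom`, no proof hole.

THE ONE CHARACTER. Every phase in this file is derived from the tree's adelic character `adeleAddChar F` — whose
archimedean component is FIXED once and for all in `AdelicHeisenbergSchrodinger.lean` as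
`archLinChar F w a := 𝐞(−piTracePairing F ι a w) = exp(−2πi Σ_i Tr(a_i w_i))` (Tate's sign,
`adeleAddChar_infiniteAdeleInl : ψ_K(y, 0) = 𝐞(−Tr y)`) — and from Folland's multiplier `rhoMul p q x =
exp(i(2π q·x + π p·q))` (`SchrodingerWeyl.lean`).  Nothing is re-chosen: the frequency vector `follandFreq e w` below is
DEFINED so that `follandFreq e w · (e u) = −piTracePairing u w` (`follandFreq_dotProduct_apply`), i.e. so that the two
characters agree, and the residual half-phase `e^{−iπ p·q}` is Folland's own symmetric normalisation.

CONTENT. For the global Schrödinger representation `ρ = adelicSchrodinger F ι T` on `𝒮(𝔸_F^ι) = 𝓢((F ⊗ ℝ)^ι) ⊗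
𝒮((𝔸_F^∞)^ι)` (`piSchwartzBruhatEquiv`) and ARCHIMEDEAN vectors `archVec a := piAdeleSplit (a, 0)`:

* §1 `archVec`, `archMat T` (archimedean part of an adelic matrix), `T *ᵥ archVec a = archVec (archMat T *ᵥ a)`,
  the character `ψ_F(⟨v, archVec b⟩) = archLinChar b v_∞`, and archimedean stability of `𝔸_F`-linear maps
  (`archIdem = (1, 0)`);
* §2 **`adelicSchrodinger_ofVec_archVec_tmul`**: `ρ((archVec a, archVec w), 0) (Φ_∞ ⊗ f) = (archModTrans T a w Φ_∞) ⊗ f`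
  with `archModTrans T a w := archLinCharCLM (archMat T *ᵥ w) ∘ (Φ ↦ Φ(· + a))` — the archimedean Heisenberg
  operators act on the archimedean factor only;
* §3 **Folland dictionary**: for any real coordinates `e : (ι → F ⊗ ℝ) ≃L[ℝ] (σ → ℝ)`,
  `archModTrans T a w = exp(−iπ p·q) • rhoSD e p q` with `p = e a`, `q = follandFreq e (archMat T *ᵥ w)`
  (`archModTrans_eq_smul_rhoSD`);
* §4 **covariance transfer**: if `(g, M) ∈ Mp_ψ(W_𝔸)` (`Implements ρ (ofSymplectic g) M`) and `M = A ⊗ M_f` on pure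
  tensors with `M_f ≠ 0`, then `A (archModTrans T a w Φ) = ψ_F(f_g(V)) • archModTrans T a' w' (A Φ)` where
  `V = (archVec a, archVec w)`, `(archVec a', archVec w') = g V` and `f_g` is Weil's quadratic character of the section
  `ofSymplectic` (`arch_covariant_of_implements`); in Folland's coordinates this is PROJECTIVE covariance
  `A ρ_D(p,q) = χ • ρ_D(p',q') A` with an explicit nowhere-zero cocycle (`arch_covariant_rhoSD_of_implements`) — the
  hypothesis shape of `SegalBargmann.exists_ne_zero_smul_piBoxTensor_proj`.

## References
* [Weil1964] A. Weil, *Sur certains groupes d'opérateurs unitaires*, Acta Math. 111 (1964), Chap. I n° 4 p. 149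
  (`U(w)`), n° 5 pp. 150–151 (the section `σ ↦ (σ, f_σ)`).
* [Folland1989] G. B. Folland, *Harmonic Analysis in Phase Space*, Princeton UP (1989), §1.3 (1.25).
* [CasselsFrohlichANT1967] J. Tate, Fourier analysis in number fields …, Ch. XV §2.2 (`ψ_∞ = e^{−2πi Tr}`).

## Provenance

LEAN-IN-TREE rule (2026-08-18), pub-hodgecm model-construction sub-cell, seat mc-binder-2 gen 3 (RULING (F′)
2026-08-18: (⊗S)-𝔸 (iii)(d1)).
-/

set_option autoImplicit false

noncomputable section

open scoped Matrix SchwartzMap TensorProduct Real Classical FourierTransform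
open Complex NumberField NumberField.mixedEmbedding IsDedekindDomain
open Literature.NumberTheory.Automorphic Literature.RepresentationTheory.HeisenbergGroup
open Literature.Analysis.SegalBargmann

namespace Literature.NumberTheory.Weil1964

variable {F : Type} [Field F] [NumberField F] {ι : Type}

/-! ## §1 Archimedean vectors, archimedean parts of matrices, characters -/

section ArchVec

variable (F ι) in
/-- **An archimedean vector**: `archVec a := piAdeleSplit (a, 0) ∈ 𝔸_F^ι` (finite part zero). [folklore] -/
def archVec (a : ι → mixedSpace F) : ι → AdeleRing (𝓞 F) F := piAdeleSplit F ι (a, 0)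

/-- `(archVec a)_∞ = a`. [folklore] -/
@[simp] theorem piArch_archVec (a : ι → mixedSpace F) : piArch F ι (archVec F ι a) = a :=
  piArch_piAdeleSplit (a, 0)

/-- `(archVec a)_f = 0`. [folklore] -/
@[simp] theorem piFinite_archVec (a : ι → mixedSpace F) : piFinite F ι (archVec F ι a) = 0 :=
  piFinite_piAdeleSplit (a, 0)

/-- Components: `archVec a i = (a_i, 0)` through `K_∞ ≅ K ⊗ ℝ`. [folklore] -/
theorem archVec_apply_fst (a : ι → mixedSpace F) (i : ι) :
    (archVec F ι a i).1 = (InfiniteAdeleRing.ringEquiv_mixedSpace F).symm (a i) := rfl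

/-- see `archVec_apply_fst`. [folklore] -/
@[simp] theorem archVec_apply_snd (a : ι → mixedSpace F) (i : ι) : (archVec F ι a i).2 = 0 := rfl

/-- `archVec` is additive. [folklore] -/
theorem archVec_add (a b : ι → mixedSpace F) : archVec F ι (a + b) = archVec F ι a + archVec F ι b := by
  rw [archVec, archVec, archVec, ← map_add, Prod.mk_add_mk, add_zero]

/-- Adding an archimedean vector: `v + archVec a = split (v_∞ + a, v_f)`. [folklore] -/
theorem add_archVec (v : ι → AdeleRing (𝓞 F) F) (a : ι → mixedSpace F) :
    v + archVec F ι a = piAdeleSplit F ι (piArch F ι v + a, piFinite F ι v) := by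
  conv_lhs => rw [eq_piAdeleSplit F ι v]
  rw [archVec, ← map_add, Prod.mk_add_mk, add_zero]

/-- A vector with zero finite part is archimedean: `v = archVec v_∞`. [folklore] -/
theorem eq_archVec_of_piFinite_eq_zero {v : ι → AdeleRing (𝓞 F) F} (hv : piFinite F ι v = 0) :
    v = archVec F ι (piArch F ι v) := by
  conv_lhs => rw [eq_piAdeleSplit F ι v, hv]
  rfl

variable (F) in
/-- **The archimedean idempotent** `(1, 0) ∈ 𝔸_F = F_∞ × 𝔸_F^∞`. [folklore] -/
def archIdem : AdeleRing (𝓞 F) F := ((1 : InfiniteAdeleRing F), (0 : FiniteAdeleRing (𝓞 F) F))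

/-- `(1,0) · archVec a = archVec a`. [folklore] -/
theorem archIdem_smul_archVec (a : ι → mixedSpace F) : archIdem F • archVec F ι a = archVec F ι a := by
  funext i
  refine Prod.ext ?_ ?_
  · show (archIdem F).1 * (archVec F ι a i).1 = _
    rw [archIdem, one_mul]
  · show (archIdem F).2 * (archVec F ι a i).2 = _
    rw [archVec_apply_snd, mul_zero]

/-- A vector fixed by `(1,0)` has zero finite part. [folklore] -/
theorem piFinite_eq_zero_of_archIdem_smul {v : ι → AdeleRing (𝓞 F) F} (hv : archIdem F • v = v) :
    piFinite F ι v = 0 := by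
  funext i
  have h := congrArg (fun w : ι → AdeleRing (𝓞 F) F => (w i).2) hv
  simp only [Pi.smul_apply, smul_eq_mul] at h
  rw [piFinite_apply, ← h]
  show (archIdem F).2 * (v i).2 = 0
  rw [archIdem, zero_mul]

/-- **`𝔸_F`-linear maps of `𝔸_F^ι × 𝔸_F^ι` preserve archimedean pairs**: `g (archVec a, archVec w)` is again
a pair of archimedean vectors (`g` commutes with the idempotent `(1,0)`). [folklore] -/
theorem map_archVec_pair (g : ((ι → AdeleRing (𝓞 F) F) × (ι → AdeleRing (𝓞 F) F)) →ₗ[AdeleRing (𝓞 F) F]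
      ((ι → AdeleRing (𝓞 F) F) × (ι → AdeleRing (𝓞 F) F))) (a w : ι → mixedSpace F) :
    g (archVec F ι a, archVec F ι w) =
      (archVec F ι (piArch F ι (g (archVec F ι a, archVec F ι w)).1),
        archVec F ι (piArch F ι (g (archVec F ι a, archVec F ι w)).2)) := by
  have hfix : archIdem F • g (archVec F ι a, archVec F ι w) = g (archVec F ι a, archVec F ι w) := by
    rw [← map_smul, Prod.smul_mk, archIdem_smul_archVec, archIdem_smul_archVec]
  have h1 : archIdem F • (g (archVec F ι a, archVec F ι w)).1 = (g (archVec F ι a, archVec F ι w)).1 :=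
    congrArg Prod.fst hfix
  have h2 : archIdem F • (g (archVec F ι a, archVec F ι w)).2 = (g (archVec F ι a, archVec F ι w)).2 :=
    congrArg Prod.snd hfix
  exact Prod.ext (eq_archVec_of_piFinite_eq_zero (piFinite_eq_zero_of_archIdem_smul h1))
    (eq_archVec_of_piFinite_eq_zero (piFinite_eq_zero_of_archIdem_smul h2))

variable [Fintype ι]

variable (F ι) in
/-- **The archimedean part of an adelic matrix**: `(archMat T) i j = (T i j)_∞ ∈ K ⊗ ℝ`. [folklore] -/
def archMat (T : Matrix ι ι (AdeleRing (𝓞 F) F)) : Matrix ι ι (mixedSpace F) :=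
  fun i j => InfiniteAdeleRing.ringEquiv_mixedSpace F (T i j).1

/-- **`T · archVec a = archVec (T_∞ · a)`**: an adelic matrix maps archimedean vectors to archimedean vectors,
acting through its archimedean part. [folklore] -/
theorem mulVec_archVec (T : Matrix ι ι (AdeleRing (𝓞 F) F)) (a : ι → mixedSpace F) :
    T *ᵥ archVec F ι a = archVec F ι (archMat F ι T *ᵥ a) := by
  funext i
  refine Prod.ext ?_ ?_
  · rw [Matrix.mulVec, dotProduct, AdeleRing.fst_sum, archVec_apply_fst, Matrix.mulVec, dotProduct, map_sum]
    refine Finset.sum_congr rfl fun j _ => ?_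
    rw [show (T i j * archVec F ι a j).1 = (T i j).1 * (archVec F ι a j).1 from rfl, archVec_apply_fst, map_mul,
      archMat, RingEquiv.symm_apply_apply]
  · rw [Matrix.mulVec, dotProduct, AdeleRing.snd_sum, archVec_apply_snd]
    refine Finset.sum_eq_zero fun j _ => ?_
    rw [show (T i j * archVec F ι a j).2 = (T i j).2 * (archVec F ι a j).2 from rfl, archVec_apply_snd, mul_zero]

/-- The trace pairing is symmetric. [folklore] -/
theorem piTracePairing_comm (a w : ι → mixedSpace F) : piTracePairing F ι a w = piTracePairing F ι w a := by
  simp only [piTracePairing_apply, mul_comm]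

/-- **The character at an archimedean vector**: `ψ_F(⟨v, archVec b⟩) = 𝐞(−⟨v_∞, b⟩) = archLinChar b v_∞`.
[cite: CasselsFrohlichANT1967, Ch. XV §2.2] -/
theorem linChar_archVec (b : ι → mixedSpace F) (v : ι → AdeleRing (𝓞 F) F) :
    linChar F (archVec F ι b) v = archLinChar F b (piArch F ι v) := by
  rw [linChar_apply, dotProduct, archLinChar_apply, archVec, adeleAddChar_sum_mul_piAdeleSplit]
  simp only [Pi.zero_apply, mul_zero, Finset.sum_const_zero, AddChar.map_zero_eq_one, Circle.coe_one, mul_one,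
    piTracePairing_comm b]

end ArchVec

/-! ## §2 The archimedean Heisenberg operators act on the archimedean factor -/

section ArchOps

variable [Fintype ι]

variable (F ι) in
/-- **The archimedean modulated translation** `Φ ↦ 𝐞(−⟨·, T_∞ w⟩) · Φ(· + a)` on `𝓢((F ⊗ ℝ)^ι)`
(`archLinCharCLM ∘ compSubConstCLM (−a)`). [cite: Weil1964, Chap. I n° 4 p. 149] -/
def archModTrans (T : Matrix ι ι (AdeleRing (𝓞 F) F)) (a w : ι → mixedSpace F) :
    𝓢((ι → mixedSpace F), ℂ) →L[ℂ] 𝓢((ι → mixedSpace F), ℂ) :=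
  (archLinCharCLM F (archMat F ι T *ᵥ w)).comp (SchwartzMap.compSubConstCLM ℂ (-a))

/-- Pointwise: `archModTrans T a w Φ x = archLinChar (T_∞ w) x * Φ (x + a)`. [folklore] -/
@[simp] theorem archModTrans_apply (T : Matrix ι ι (AdeleRing (𝓞 F) F)) (a w : ι → mixedSpace F)
    (Φ : 𝓢((ι → mixedSpace F), ℂ)) (x : ι → mixedSpace F) :
    archModTrans F ι T a w Φ x = archLinChar F (archMat F ι T *ᵥ w) x * Φ (x + a) := by
  rw [archModTrans, ContinuousLinearMap.comp_apply, archLinCharCLM_apply, SchwartzMap.compSubConstCLM_apply,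
    sub_neg_eq_add]

variable [DecidableEq ι] (T : Matrix ι ι (AdeleRing (𝓞 F) F))

/-- **The archimedean Heisenberg operators on pure tensors, as functions**:
`ρ((archVec a, archVec w), 0) (Φ_∞ ⊗ f) = (archModTrans T a w Φ_∞) ⊗ f`. [cite: Weil1964, Chap. I n° 4 p. 149] -/
theorem coe_adelicSchrodinger_ofVec_archVec_tmul (a w : ι → mixedSpace F) (Φ : 𝓢((ι → mixedSpace F), ℂ))
    (f : FinSB F ι) :
    ((adelicSchrodinger F ι T (Heisenberg.ofVec (polar (adelicForm F ι T)) (archVec F ι a, archVec F ι w))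
        (piSchwartzBruhatEquiv F ι (Φ ⊗ₜ f)) : piSchwartzBruhat F ι) : (ι → AdeleRing (𝓞 F) F) → ℂ) =
      ((piSchwartzBruhatEquiv F ι (archModTrans F ι T a w Φ ⊗ₜ f) : piSchwartzBruhat F ι) :
        (ι → AdeleRing (𝓞 F) F) → ℂ) := by
  rw [coe_adelicSchrodinger_ofVec, mulVec_archVec, coe_piSchwartzBruhatEquiv_tmul, coe_piSchwartzBruhatEquiv_tmul]
  funext v
  rw [mulChar_apply, translate_apply, linChar_archVec, add_archVec, piArch_piAdeleSplit, piFinite_piAdeleSplit,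
    archModTrans_apply, mul_assoc]

/-- **The archimedean Heisenberg operators on pure tensors**:
`ρ((archVec a, archVec w), 0) (Φ_∞ ⊗ f) = (archModTrans T a w Φ_∞) ⊗ f` in `𝒮(𝔸_F^ι)`.
[cite: Weil1964, Chap. I n° 4 p. 149] -/
theorem adelicSchrodinger_ofVec_archVec_tmul (a w : ι → mixedSpace F) (Φ : 𝓢((ι → mixedSpace F), ℂ))
    (f : FinSB F ι) :
    adelicSchrodinger F ι T (Heisenberg.ofVec (polar (adelicForm F ι T)) (archVec F ι a, archVec F ι w))
        (piSchwartzBruhatEquiv F ι (Φ ⊗ₜ f)) =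
      piSchwartzBruhatEquiv F ι (archModTrans F ι T a w Φ ⊗ₜ f) :=
  Subtype.ext (coe_adelicSchrodinger_ofVec_archVec_tmul T a w Φ f)

/-- General archimedean elements: `ρ((archVec a, archVec w), t) (Φ_∞ ⊗ f) = ψ_F(t) • (archModTrans T a w Φ_∞) ⊗ f`.
[cite: Weil1964, Chap. I n° 4 p. 149] -/
theorem adelicSchrodinger_mk_archVec_tmul (a w : ι → mixedSpace F) (t : AdeleRing (𝓞 F) F)
    (Φ : 𝓢((ι → mixedSpace F), ℂ)) (f : FinSB F ι) :
    adelicSchrodinger F ι T (⟨(archVec F ι a, archVec F ι w), t⟩ : AdelicHeisenberg F ι T)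
        (piSchwartzBruhatEquiv F ι (Φ ⊗ₜ f)) =
      ((adeleAddChar F t : Circle) : ℂ) • piSchwartzBruhatEquiv F ι (archModTrans F ι T a w Φ ⊗ₜ f) := by
  rw [← Heisenberg.ofVec_mul_ofCenter, map_mul, Module.End.mul_apply, adelicSchrodinger_ofCenter, map_smul,
    adelicSchrodinger_ofVec_archVec_tmul]

end ArchOps

/-! ## §3 The Folland dictionary -/

section Folland

/-- `𝐞 s = exp(2πi s)` as a complex number (Mathlib `Real.fourierChar`, by `rfl`). [folklore] -/
private theorem fourierChar_coe' (s : ℝ) : ((𝐞 s : Circle) : ℂ) = cexp (((2 * π * s : ℝ) : ℂ) * I) := rfl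

variable [Fintype ι] {σ : Type*}

variable (F ι) in
/-- **Folland's frequency vector of `w ∈ (F ⊗ ℝ)^ι` in real coordinates `e`**: the unique `q ∈ ℝ^σ` with
`q · (e u) = −⟨u, w⟩_{Tr}` for all `u` (`follandFreq_dotProduct_apply`), i.e. `q_k = −⟨e⁻¹ δ_k, w⟩_{Tr}`; the sign is
Tate's `ψ_∞ = e^{−2πi Tr}` (`adeleAddChar_infiniteAdeleInl`). [folklore] -/
def follandFreq (e : (ι → mixedSpace F) ≃L[ℝ] (σ → ℝ)) (w : ι → mixedSpace F) : σ → ℝ :=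
  fun k => -(piTracePairing F ι (e.symm (Pi.single k 1)) w)

variable [Fintype σ]

/-- **Defining property**: `follandFreq e w · (e u) = −⟨u, w⟩_{Tr}`. [folklore] -/
theorem follandFreq_dotProduct_apply (e : (ι → mixedSpace F) ≃L[ℝ] (σ → ℝ)) (w u : ι → mixedSpace F) :
    follandFreq F ι e w ⬝ᵥ e u = -(piTracePairing F ι u w) := by
  have h1 : e u = ∑ k, e u k • (Pi.single k (1 : ℝ) : σ → ℝ) := by
    conv_lhs => rw [← Finset.univ_sum_single (e u)]
    refine Finset.sum_congr rfl fun k _ => ?_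
    rw [← Pi.single_smul, smul_eq_mul, mul_one]
  have hu : u = ∑ k, e u k • e.symm (Pi.single k 1) := by
    apply e.injective
    rw [map_sum]
    simp only [map_smul, ContinuousLinearEquiv.apply_symm_apply]
    exact h1
  conv_rhs => rw [hu]
  rw [map_sum, LinearMap.sum_apply, ← Finset.sum_neg_distrib, dotProduct]
  refine Finset.sum_congr rfl fun k _ => ?_
  rw [map_smul, LinearMap.smul_apply, smul_eq_mul, follandFreq]
  ring

omit [Fintype σ] in
/-- `follandFreq` is additive in `w`. [folklore] -/
theorem follandFreq_add (e : (ι → mixedSpace F) ≃L[ℝ] (σ → ℝ)) (w w' : ι → mixedSpace F) :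
    follandFreq F ι e (w + w') = follandFreq F ι e w + follandFreq F ι e w' := by
  funext k
  simp only [follandFreq, map_add, Pi.add_apply, neg_add]

/-- **THE DICTIONARY**: `archLinCharCLM w' ∘ (Φ ↦ Φ(· + a)) = e^{−iπ p·q} • rhoSD e p q` with `p = e a`,
`q = follandFreq e w'` — the archimedean modulated translation IS Folland's transported Heisenberg operator up to
Folland's symmetric half-phase. [cite: Folland1989, (1.25)] -/
theorem archLinCharCLM_comp_translate_eq_smul_rhoSD (e : (ι → mixedSpace F) ≃L[ℝ] (σ → ℝ))
    (a w' : ι → mixedSpace F) (Φ : 𝓢((ι → mixedSpace F), ℂ)) :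
    archLinCharCLM F w' (SchwartzMap.compSubConstCLM ℂ (-a) Φ) =
      cexp (-((((π * (e a ⬝ᵥ follandFreq F ι e w') : ℝ) : ℂ)) * I)) • rhoSD e (e a) (follandFreq F ι e w') Φ := by
  ext y
  rw [archLinCharCLM_apply, SchwartzMap.compSubConstCLM_apply, sub_neg_eq_add, smul_apply, rhoSD_apply,
    ContinuousLinearEquiv.symm_apply_apply, archLinChar_apply, fourierChar_coe', rhoMul, smul_eq_mul, ← mul_assoc,
    ← Complex.exp_add]
  congr 2
  rw [show (∑ k, follandFreq F ι e w' k * e y k) = follandFreq F ι e w' ⬝ᵥ e y from rfl,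
    follandFreq_dotProduct_apply, show (∑ k, e a k * follandFreq F ι e w' k) = e a ⬝ᵥ follandFreq F ι e w' from rfl]
  push_cast
  ring

variable (T : Matrix ι ι (AdeleRing (𝓞 F) F))

/-- **`archModTrans T a w = e^{−iπ p·q} • rhoSD e p q`**, `p = e a`, `q = follandFreq e (T_∞ w)`.
[cite: Folland1989, (1.25)] -/
theorem archModTrans_eq_smul_rhoSD (e : (ι → mixedSpace F) ≃L[ℝ] (σ → ℝ)) (a w : ι → mixedSpace F)
    (Φ : 𝓢((ι → mixedSpace F), ℂ)) :
    archModTrans F ι T a w Φ =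
      cexp (-((((π * (e a ⬝ᵥ follandFreq F ι e (archMat F ι T *ᵥ w)) : ℝ) : ℂ)) * I)) •
        rhoSD e (e a) (follandFreq F ι e (archMat F ι T *ᵥ w)) Φ := by
  rw [archModTrans, ContinuousLinearMap.comp_apply]
  exact archLinCharCLM_comp_translate_eq_smul_rhoSD e a _ Φ

end Folland

/-! ## §4 Covariance transfer: from `Implements` on `𝒮(𝔸_F^ι)` to (projective) Folland covariance -/

section Covariance

/-- A linear form taking the value `1` on a nonzero vector (over a field). [folklore] -/
private theorem exists_dual_eq_one' {V : Type*} [AddCommGroup V] [Module ℂ V] {v : V} (hv : v ≠ 0) :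
    ∃ ψ : Module.Dual ℂ V, ψ v = 1 := by
  obtain ⟨φ, hφ⟩ := not_forall.mp (mt (Module.forall_dual_apply_eq_zero_iff ℂ v).mp hv)
  exact ⟨(φ v)⁻¹ • φ, by simp [inv_mul_cancel₀ hφ]⟩

/-- Cancellation of a nonzero right tensor factor: `x ⊗ n = y ⊗ n`, `n ≠ 0` ⇒ `x = y`. [folklore] -/
theorem tmul_left_cancel {X N : Type*} [AddCommGroup X] [Module ℂ X] [AddCommGroup N] [Module ℂ N]
    {x y : X} {n : N} (hn : n ≠ 0) (h : x ⊗ₜ[ℂ] n = y ⊗ₜ[ℂ] n) : x = y := by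
  obtain ⟨ψ, hψ⟩ := exists_dual_eq_one' hn
  have h1 := congrArg (fun z => TensorProduct.rid ℂ X (LinearMap.lTensor X ψ z)) h
  simpa only [LinearMap.lTensor_tmul, hψ, TensorProduct.rid_tmul, one_smul] using h1

variable [Fintype ι] [DecidableEq ι] (T : Matrix ι ι (AdeleRing (𝓞 F) F))

/-- The archimedean part of the action of `g ∈ Sp(W_𝔸)` on an archimedean pair `(a, w)`. [folklore] -/
def archAct (g : symplecticGroup (polar (adelicForm F ι T))) (aw : (ι → mixedSpace F) × (ι → mixedSpace F)) :
    (ι → mixedSpace F) × (ι → mixedSpace F) :=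
  (piArch F ι (g.1 (archVec F ι aw.1, archVec F ι aw.2)).1, piArch F ι (g.1 (archVec F ι aw.1, archVec F ι aw.2)).2)

/-- `g (archVec a, archVec w) = (archVec (archAct g (a,w)).1, archVec (archAct g (a,w)).2)`. [folklore] -/
theorem apply_archVec_pair (g : symplecticGroup (polar (adelicForm F ι T))) (a w : ι → mixedSpace F) :
    g.1 (archVec F ι a, archVec F ι w) =
      (archVec F ι (archAct T g (a, w)).1, archVec F ι (archAct T g (a, w)).2) :=
  map_archVec_pair (g.1 : ((ι → AdeleRing (𝓞 F) F) × (ι → AdeleRing (𝓞 F) F)) →ₗ[AdeleRing (𝓞 F) F]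
    ((ι → AdeleRing (𝓞 F) F) × (ι → AdeleRing (𝓞 F) F))) a w

/-- **Weil's cocycle phase** of `g` at the archimedean pair `(a, w)`: `ψ_F(f_g(archVec a, archVec w))`,
`f_g(V) = ½ (B(gV, gV) − B(V, V))` the quadratic character of the section `ofSymplectic`. [cite: Weil1964, n° 5, pp. 150–151] -/
def weilPhase (g : symplecticGroup (polar (adelicForm F ι T))) (aw : (ι → mixedSpace F) × (ι → mixedSpace F)) : ℂ :=
  ((adeleAddChar F ((ofSymplectic (polar (adelicForm F ι T)) g).f (archVec F ι aw.1, archVec F ι aw.2)) : Circle) : ℂ)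

/-- Weil's cocycle phase is unimodular, hence nonzero. [folklore] -/
theorem weilPhase_ne_zero (g : symplecticGroup (polar (adelicForm F ι T)))
    (aw : (ι → mixedSpace F) × (ι → mixedSpace F)) : weilPhase T g aw ≠ 0 :=
  Circle.coe_ne_zero _

/-- **Covariance transfer.** Let `(g, M)` implement `g` on the global Schrödinger representation
(`Implements ρ (ofSymplectic g) M`) and let `M` be a tensor `A ⊗ M_f` on pure tensors with `M_f f₀ ≠ 0` for some
`f₀`. Then the archimedean factor `A` is covariant over the archimedean modulated translations up to Weil's cocycle
phase: `A (archModTrans T a w Φ) = ψ_F(f_g V) • archModTrans T a' w' (A Φ)`, `(a', w') = archAct g (a, w)`.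
[cite: MoeglinVignerasWaldspurger1987, Chap. 2 II.1 (A)] -/
theorem arch_covariant_of_implements (g : symplecticGroup (polar (adelicForm F ι T)))
    (M : piSchwartzBruhat F ι ≃ₗ[ℂ] piSchwartzBruhat F ι)
    (hM : Implements (adelicSchrodinger F ι T) (ofSymplectic (polar (adelicForm F ι T)) g) M)
    (A : 𝓢((ι → mixedSpace F), ℂ) →ₗ[ℂ] 𝓢((ι → mixedSpace F), ℂ)) (Mf : FinSB F ι →ₗ[ℂ] FinSB F ι)
    (hAM : ∀ (Φ : 𝓢((ι → mixedSpace F), ℂ)) (f : FinSB F ι),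
      M (piSchwartzBruhatEquiv F ι (Φ ⊗ₜ f)) = piSchwartzBruhatEquiv F ι (A Φ ⊗ₜ Mf f))
    {f₀ : FinSB F ι} (hf₀ : Mf f₀ ≠ 0) (a w : ι → mixedSpace F) (Φ : 𝓢((ι → mixedSpace F), ℂ)) :
    A (archModTrans F ι T a w Φ) =
      weilPhase T g (a, w) • archModTrans F ι T (archAct T g (a, w)).1 (archAct T g (a, w)).2 (A Φ) := by
  have h := hM (Heisenberg.ofVec (polar (adelicForm F ι T)) (archVec F ι a, archVec F ι w))
    (piSchwartzBruhatEquiv F ι (Φ ⊗ₜ f₀))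
  rw [adelicSchrodinger_ofVec_archVec_tmul, hAM, hAM] at h
  -- the right-hand side: `(ofSymplectic g).act (ofVec V) = ⟨g V, f_g V⟩`
  have hact : (ofSymplectic (polar (adelicForm F ι T)) g).act
      (Heisenberg.ofVec (polar (adelicForm F ι T)) (archVec F ι a, archVec F ι w)) =
      (⟨(archVec F ι (archAct T g (a, w)).1, archVec F ι (archAct T g (a, w)).2),
        (ofSymplectic (polar (adelicForm F ι T)) g).f (archVec F ι a, archVec F ι w)⟩ : AdelicHeisenberg F ι T) := by
    apply Heisenberg.ext
    · rw [Heisenberg.PseudoSymplectic.act_v, ofSymplectic_σ, Heisenberg.ofVec_v, apply_archVec_pair]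
    · rw [Heisenberg.PseudoSymplectic.act_t, Heisenberg.ofVec_t, zero_add, Heisenberg.ofVec_v]
  rw [hact, adelicSchrodinger_mk_archVec_tmul, ← map_smul, TensorProduct.smul_tmul'] at h
  exact tmul_left_cancel hf₀ ((piSchwartzBruhatEquiv F ι).injective h)

variable {σ : Type*} [Fintype σ]

/-- The Folland cocycle of `g` at `(a, w)` in coordinates `e`: Weil's phase times the quotient of Folland's
half-phases before and after. [folklore] -/
def follandCocycle (e : (ι → mixedSpace F) ≃L[ℝ] (σ → ℝ)) (g : symplecticGroup (polar (adelicForm F ι T)))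
    (aw : (ι → mixedSpace F) × (ι → mixedSpace F)) : ℂ :=
  weilPhase T g aw *
    (cexp (-((((π * (e (archAct T g aw).1 ⬝ᵥ follandFreq F ι e (archMat F ι T *ᵥ (archAct T g aw).2)) : ℝ) : ℂ)) *
        I)) *
      cexp ((((π * (e aw.1 ⬝ᵥ follandFreq F ι e (archMat F ι T *ᵥ aw.2)) : ℝ) : ℂ)) * I))

/-- The Folland cocycle vanishes nowhere. [folklore] -/
theorem follandCocycle_ne_zero (e : (ι → mixedSpace F) ≃L[ℝ] (σ → ℝ))
    (g : symplecticGroup (polar (adelicForm F ι T))) (aw : (ι → mixedSpace F) × (ι → mixedSpace F)) :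
    follandCocycle T e g aw ≠ 0 :=
  mul_ne_zero (weilPhase_ne_zero T g aw) (mul_ne_zero (Complex.exp_ne_zero _) (Complex.exp_ne_zero _))

/-- **Projective Folland covariance of the archimedean factor** (parametrised form): with `p = e a`,
`q = follandFreq e (T_∞ w)` and `(a', w') = archAct g (a, w)`,
`A (rhoSD e p q Φ) = follandCocycle e g (a,w) • rhoSD e p' q' (A Φ)`. [cite: Folland1989, Prop. (1.43)] -/
theorem arch_covariant_rhoSD_of_implements (e : (ι → mixedSpace F) ≃L[ℝ] (σ → ℝ))
    (g : symplecticGroup (polar (adelicForm F ι T)))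
    (M : piSchwartzBruhat F ι ≃ₗ[ℂ] piSchwartzBruhat F ι)
    (hM : Implements (adelicSchrodinger F ι T) (ofSymplectic (polar (adelicForm F ι T)) g) M)
    (A : 𝓢((ι → mixedSpace F), ℂ) →ₗ[ℂ] 𝓢((ι → mixedSpace F), ℂ)) (Mf : FinSB F ι →ₗ[ℂ] FinSB F ι)
    (hAM : ∀ (Φ : 𝓢((ι → mixedSpace F), ℂ)) (f : FinSB F ι),
      M (piSchwartzBruhatEquiv F ι (Φ ⊗ₜ f)) = piSchwartzBruhatEquiv F ι (A Φ ⊗ₜ Mf f))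
    {f₀ : FinSB F ι} (hf₀ : Mf f₀ ≠ 0) (a w : ι → mixedSpace F) (Φ : 𝓢((ι → mixedSpace F), ℂ)) :
    A (rhoSD e (e a) (follandFreq F ι e (archMat F ι T *ᵥ w)) Φ) =
      follandCocycle T e g (a, w) •
        rhoSD e (e (archAct T g (a, w)).1) (follandFreq F ι e (archMat F ι T *ᵥ (archAct T g (a, w)).2)) (A Φ) := by
  have h := arch_covariant_of_implements T g M hM A Mf hAM hf₀ a w Φ
  rw [archModTrans_eq_smul_rhoSD T e, archModTrans_eq_smul_rhoSD T e, map_smul, smul_smul] at h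
  -- divide by Folland's half-phase on the left
  have hc0 : cexp (-((((π * (e a ⬝ᵥ follandFreq F ι e (archMat F ι T *ᵥ w)) : ℝ) : ℂ)) * I)) ≠ 0 :=
    Complex.exp_ne_zero _
  have h3 : A (rhoSD e (e a) (follandFreq F ι e (archMat F ι T *ᵥ w)) Φ) =
      ((cexp (-((((π * (e a ⬝ᵥ follandFreq F ι e (archMat F ι T *ᵥ w)) : ℝ) : ℂ)) * I)))⁻¹ *
        (weilPhase T g (a, w) *
          cexp (-((((π * (e (archAct T g (a, w)).1 ⬝ᵥ
            follandFreq F ι e (archMat F ι T *ᵥ (archAct T g (a, w)).2)) : ℝ) : ℂ)) * I)))) •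
        rhoSD e (e (archAct T g (a, w)).1) (follandFreq F ι e (archMat F ι T *ᵥ (archAct T g (a, w)).2))
          (A Φ) := by
    rw [← smul_smul, ← h, smul_smul, inv_mul_cancel₀ hc0, one_smul]
  rw [h3, follandCocycle, Complex.exp_neg, Complex.exp_neg, inv_inv]
  congr 1
  ring

end Covariance

end Literature.NumberTheory.Weil1964

end
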